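import Summits.HodgeConjecture.CorCM.HypLiu418.A3Liu418GSThmD6OneCurve
import Literature.NumberTheory.Automorphic.Liu2021.AdmissibleRepTransport
import HarnessLib

/-!
# The registered d6 carrier `ω⋆ = ω(μ, ε, χ)|_{U(J⋆)}` of the unitary Shimura CURVE is SMOOTH

Cell `hodgecm-mathlib`, crux `HLiu418` (stmt-HodgeConjecture-24832), d6 line (`Cruxes/HLiu418/Lines/d6_cm_curve`, HOME card v3.9 §0⁷ (IV)):
the S2′ assembly of record (`S2primeAlphaAssembly.probe.v5`, A-p11 (g12)) consumes a socket `SocketKw C ρW` («every vector of the carrier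
is fixed by some small level»), discharged generically from SMOOTHNESS of `ρW` (`socketKw_of_isSmoothRep`).  The REGISTERED carrier of
the d6 texts (`thmD6OneCurveCUF`, `S2primeShape`) is

  `ω⋆ := (rhoVAtLine F⁺ F c 2 finProdFinEquiv (diag dJ) … (hsChiGS F finProdFinEquiv dJ hdJ hdJ0 χₕ hχu hχs) a χ).comp
          (finAdelicCongr F⁺ F c g⋆ ht hg).symm.toMonoidHom : Representation ℂ (U(J⋆)(𝔸_{F⁺,f})) (ω(μ, ε, χ) at the line ⟨a⟩)`,

the Weil `χ_W`-coinvariants at the χ-splitting `sChiGS` read on `U(J⋆)(𝔸_f)` through the rational frame `g⋆` (`ᵗ(c g⋆) (t • J⋆) g⋆ = diag dJ`).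
This file proves it is smooth in [Liu2021, Def. 4.11]'s sense (`IsSmoothRep`: every vector is fixed by an open subgroup):
★ `rhoAtLine_smooth` ([GelbartRogawski1991, Prop. 3.1.1]: locally constant splittings ⇒ smooth coinvariants) fed with the continuity of the
χ-splitting ★ `hscChiGS` and of the frame transport `finAdelicCongr` (a `ContinuousMulEquiv`).

* `isSmoothRep_rhoVAtLine_chiGS_comp` — for ANY continuous `ι : G →* U(diag dJ)(𝔸_f)`;
* `isSmoothRep_omegaStarGS` — at the registered frame transport `ι := (finAdelicCongr F⁺ F c g⋆ ht hg).symm`.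

Theorems only (2); no definition, no named fact, no instance, no `sorry`.  Count-neutral: HC_CM is proved only modulo the 7 printed
citations until rung 0 closes.

## References
* [Liu2021] Y. Liu, *Fourier–Jacobi cycles and arithmetic relative trace formula*, Camb. J. Math. 9 (2021) = arXiv:2102.11518: Def. 4.11
  (FJcycle.tex l. 2092–2096, «irreducible admissible representation»), App. D §D.1 Steps 2–3 (l. 5217–5221).
* [GelbartRogawski1991] S. Gelbart, J. Rogawski, *L-functions and Fourier–Jacobi coefficients for the unitary group U(3)*, Invent. Math.
  105 (1991), §3.1 Prop. 3.1.1 p. 455 L1–3.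
* [BernsteinZelevinsky1976] I. N. Bernstein, A. V. Zelevinsky, *Representations of the group GL(n,F) where F is a non-archimedean local
  field*, Russian Math. Surveys 31 (1976), §2.1 (smooth representations).
-/

noncomputable section

open scoped Matrix NumberField
open NumberField NumberField.InfinitePlace
open Literature.NumberTheory.Automorphic Literature.NumberTheory.Automorphic.UnitaryGroup
open Literature.NumberTheory.Automorphic.Liu2021
open Literature.NumberTheory.GaloisRepresentations Literature.RepresentationTheory.HarrisKudlaSweet1996
open Literature.NumberTheory.GelbartRogawski1991 Literature.NumberTheory.GelbartRogawski1991.UnitaryDualPair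
open Literature.NumberTheory.Automorphic.Liu2021.Def411WeilCarriersDoubling
open Literature.NumberTheory.Automorphic.Liu2021.Def411WeilCarriers (TW JW JW_eq isSymm_TW isUnit_det_TW Chi rhoVAtLine rhoAtLine
  rhoAtLine_smooth)

namespace Summit.HodgeConjecture.CorCM.Lines.A3Liu418

variable (F : CMField) (dJ : Fin 2 → F) (hdJ : ∀ i, IsCMField.complexConj F (dJ i) = dJ i) (hdJ0 : ∀ i, dJ i ≠ 0)
  (χₕ : HeckeCharacter F) (hχu : χₕ.IsUnitary) (hχs : IsSplittingChar F 1 χₕ)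
  (a : (↥(maximalRealSubfield F))ˣ) (χ : Chi ↥(maximalRealSubfield F) F (IsCMField.complexConj F))

/-- **`ω(μ, ε, χ)` at the line `⟨a⟩`, at the χ-splitting `sChiGS`, is SMOOTH through any continuous `ι : G →* U(diag dJ)(𝔸_{F⁺,f})`**:
every vector is fixed by an open subgroup of `G` ([Liu2021, Def. 4.11] «admissible», smoothness half) — ★ `rhoAtLine_smooth` with the
continuity of the χ-splitting ★ `hscChiGS`. [cite: Liu2021, Def. 4.11 (FJcycle.tex l. 2092–2096)]
[cite: GelbartRogawski1991, §3.1 Prop. 3.1.1 p. 455 L1–3] -/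
theorem isSmoothRep_rhoVAtLine_chiGS_comp {G : Type} [Group G] [TopologicalSpace G]
    (ι : G →* UnitaryGroup.finAdelic ↥(maximalRealSubfield F) F (IsCMField.complexConj F) 2 (Matrix.diagonal dJ))
    (hι : Continuous ι) :
    IsSmoothRep
      ((rhoVAtLine ↥(maximalRealSubfield F) F (IsCMField.complexConj F) 2 (finProdFinEquiv : Fin 2 × Fin 1 ≃ Fin (2 * 1))
        (Matrix.diagonal dJ) (complexConj_imagUnit F) (imagUnit_ne_zero F) (imagUnit_mul_self F) (realDiagonal_isSymm F dJ hdJ)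
        (isUnit_det_realDiagonal F dJ hdJ hdJ0) (realDiagonal_map F dJ hdJ).symm
        (hsChiGS F finProdFinEquiv dJ hdJ hdJ0 χₕ hχu hχs) a χ).comp ι) :=
  fun v => rhoAtLine_smooth ↥(maximalRealSubfield F) F (IsCMField.complexConj F) 2 (finProdFinEquiv : Fin 2 × Fin 1 ≃ Fin (2 * 1))
    (Matrix.diagonal dJ) (complexConj_imagUnit F) (imagUnit_ne_zero F) (imagUnit_mul_self F) (realDiagonal_isSymm F dJ hdJ)
    (isUnit_det_realDiagonal F dJ hdJ hdJ0) (realDiagonal_map F dJ hdJ).symm (hsChiGS F finProdFinEquiv dJ hdJ hdJ0 χₕ hχu hχs)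
    ι hι (hscChiGS F finProdFinEquiv dJ hdJ hdJ0 χₕ hχu hχs) a χ v

/-- **The REGISTERED d6 carrier `ω⋆` on `U(J⋆)(𝔸_{F⁺,f})` is SMOOTH**: for a hermitian `J⋆`, a scalar `t ≠ 0` and a rational frame `g⋆`
with `ᵗ(c g⋆) (t • J⋆) g⋆ = diag dJ`, the carrier `ω(μ, ε, χ)` at the line `⟨a⟩` read through `(finAdelicCongr F⁺ F c g⋆ ht hg)⁻¹`
(a continuous isomorphism `U(J⋆)(𝔸_f) ≃ U(diag dJ)(𝔸_f)`) has every vector fixed by an open subgroup — the text consumed by the S2′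
socket `SocketKw` of the d6 line through `socketKw_of_isSmoothRep`. [cite: Liu2021, Def. 4.11 (FJcycle.tex l. 2092–2096)]
[cite: GelbartRogawski1991, §3.1 Prop. 3.1.1 p. 455 L1–3] -/
theorem isSmoothRep_omegaStarGS {Jstar : Matrix (Fin 2) (Fin 2) F} {t : F} (ht : t ≠ 0) (gstar : GL (Fin 2) F)
    (hg : formCongr ((IsCMField.complexConj F : F ≃ₐ[↥(maximalRealSubfield F)] F) : F →+* F) gstar (t • Jstar) =
      Matrix.diagonal dJ) :
    IsSmoothRep
      ((rhoVAtLine ↥(maximalRealSubfield F) F (IsCMField.complexConj F) 2 (finProdFinEquiv : Fin 2 × Fin 1 ≃ Fin (2 * 1))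
        (Matrix.diagonal dJ) (complexConj_imagUnit F) (imagUnit_ne_zero F) (imagUnit_mul_self F) (realDiagonal_isSymm F dJ hdJ)
        (isUnit_det_realDiagonal F dJ hdJ hdJ0) (realDiagonal_map F dJ hdJ).symm
        (hsChiGS F finProdFinEquiv dJ hdJ hdJ0 χₕ hχu hχs) a χ).comp
        (finAdelicCongr ↥(maximalRealSubfield F) F (IsCMField.complexConj F) gstar ht hg).symm.toMonoidHom) :=
  isSmoothRep_rhoVAtLine_chiGS_comp F dJ hdJ hdJ0 χₕ hχu hχs a χ _
    (finAdelicCongr ↥(maximalRealSubfield F) F (IsCMField.complexConj F) gstar ht hg).symm.continuous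

end Summit.HodgeConjecture.CorCM.Lines.A3Liu418

end
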